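import Summits.HodgeConjecture.HodgeConjecture.Theorems.Ring2HypothesesDescentAbsoluteExteriorLefschetzGraphs
import HarnessLib

/-!
# Ring 2 — hypotheses layer, descent axis: A KÜNNETH FAMILY FIXING ONLY THE LEFSCHETZ CLASSES OF THE POWERS OF AN ABELIAN VARIETY
# ACTS ON `H•(A(ℂ); ℂ) = ⋀•H¹` THROUGH `H¹` (van Geemen 6.5 for Milne's `S(A)`; step 2 of «`S(A)` acts through `H¹`»)

HONEST FRAMING (page 1, verbatim the cell's standing line): **research route conditional on HC_CM; not a
corollary; Q11.4-sentence-2 already refuted in dim ≥ 3.** Nothing in this file proves a case of the Hodge conjecture;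
nothing discharges the binder of record b06 `Ring2.Hypotheses.AbsoluteHodgeImpliesAlgebraicAV` («absolute Hodge classes
on complex abelian varieties are algebraic», `Ring2HypothesesDescent.lean` :73; OPEN); the binder table's numbers do not
move. `HC_CM` (`Theses.RankFourFaces.CMAbelianHodge`), `HC_AV`, row b06 and every hypothesis of the cell are ABSENT from this
file. Hodge ladder STAGE 3, `BINDER-OWNERS.md` row **b06**, seat `ring2-b06` (gen 85). Sequel of
`Ring2HypothesesDescentAbsoluteExteriorLefschetzGraphs` (same gen: the unit, the Casimir classes on `A^{×2}` and the transposed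
graph-type classes on `A^{×3}` of the homomorphisms `A² → A` are LEFSCHETZ classes).

WHAT IS PROVED. For a complex abelian variety `A` and a Künneth family `G` on the cohomology of the powers `A.X^{×(a+1)}` with
`G₀ = g` which fixes every LEFSCHETZ class `lefschetzPowClasses (dim A) A.X a p = D^p_hom(A^{a+1})_ℂ` of every power — i.e. for
every `g` in Milne's Tannaka-free special Lefschetz group `Milne1999.specialLefschetzGroup (dim A) A.X` together with ITS Künneth
family — gen 84's `AlgebraicStabilizerExterior` dictionary (there: `G` fixes every ALGEBRAIC class) runs VERBATIM, the three
memberships it needs being supplied by the companion: §M2 `cupPairing_apply_dual` (isometry on a dual pair), **`apply_map`**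
(`G₁ ∘ f^* = f^* ∘ g` on every `Hᵏ(A)` for every `f` underlying a HOMOMORPHISM `A² → A`), `cupPairing_eq`, `apply_top`; §M3
`one_apply_map`, **`apply_cupPowOne`** — **`g_k(v₁ ∪ ⋯ ∪ v_k) = g₁v₁ ∪ ⋯ ∪ g₁v_k`** (van Geemen 6.5: the averaging operator
`Σ_p w_p (p·pr₁ + pr₂)^*` over the HOMOMORPHISMS `p·pr₁ + pr₂ : A² → A`, gen 84's hypothesis-free `avg_cupPowOne`, `diag_avg`,
`kunneth_M1`, and ring2-ab-andre-2's `exists_vandermonde_solution`), `apply_one`. Every proof below is gen 84's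
(`Ring2HypothesesDescentAbsoluteExterior{Pullbacks,Action}`) with `algebraicPowClasses` replaced by `lefschetzPowClasses` and the
graph-type memberships by the companion's — marked `-- adapted from`. The consequences for `S(A)` itself (`g_k = ⋀ᵏ(g₁)`;
injectivity of `g ↦ g₁`; Milne Thm. 4.4 in full; Cor. 4.7 for the Tannaka-free groups) are the next file (`…ExteriorLefschetzH1`).

HONEST COLUMN. No definition, no named fact, no sorry; nothing of the cell is discharged or displayed. NOT here: the full
multiplicativity `g(x ∪ y) = g x ∪ g y` (it follows from `g_k = ⋀ᵏ(g₁)`, next file). PRESEARCH: as in the companion — van Geemen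
LNM 1594 6.4–6.5 [corpus: paper:doi-10-1007-978-3-540-49046-3-5, as quoted in `HodgeGroupExteriorAction`], Milne 1999 §4–§5 [corpus:
paper:doi-10-1215-s0012-7094-99-09620-5]; nothing treats the Künneth-family form; certification by assembly, no novelty claimed.
References (bib keys): vanGeemen1994HodgeAV (6.4–6.5), Milne1999LefschetzClasses (§4 Thm. 4.4, Cor. 4.5; §5 Prop. 5.4, Cor. 5.6–5.8,
Prop. 5.7), LangeBirkenhake1992 (§1.1, Lemma 1.1.17), HatcherAT2002 (§3.2 Thm. 3.16, §3.3 Prop. 3.38, Thm. 3.26), VoisinHodgeI2002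
(§11.3.3 Lemma 11.41), Deligne1982HodgeCycles (I §3 Prop. 3.4), Andre1996Motifs (§4.6 (ii)).
-/

noncomputable section

-- every declaration of this problem lives in `Summit.HodgeConjecture.HodgeConjecture.…` (summit = sub-problem)
set_option linter.dupNamespace false

namespace Summit.HodgeConjecture.HodgeConjecture.Ring2.Hypotheses

open CategoryTheory AlgebraicGeometry MonoidalCategory CartesianMonoidalCategory
open Literature.AlgebraicGeometry Literature.AlgebraicGeometry.Motives
open Literature.AlgebraicGeometry.HodgeTheory
open Literature.AlgebraicTopology.SingularHomology
open Literature.AlgebraicGeometry.Milne1999 (specialLefschetzGroup lefschetzPowClasses)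

/-! ## §M2 A Künneth family fixing the LEFSCHETZ classes: isometry, commutation with homomorphisms `A × A → A`, the top degree -/

namespace SpecialLefschetzExterior

section Comm

variable {A : AbelianVariety ℂ}
  {g : ∀ k : ℕ, complexBetti A.X k ≃ₗ[ℂ] complexBetti A.X k}
  {G : ∀ a k : ℕ, complexBetti (cartesianPow A.X (a + 1)) k ≃ₗ[ℂ] complexBetti (cartesianPow A.X (a + 1)) k}

/-- **A Künneth family fixing the Lefschetz classes is an isometry of the cup pairing, on a dual pair**: for `G` with `G₀ = g` fixing
`lefschetzPowClasses (dim A) A.X`, a basis `x` of `Hᵏ(A(ℂ); ℂ)` and `xd` with `⟨x_i ∪ xd_j, [A(ℂ)]⟩ = c δ_{ij}`, `c ≠ 0`: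
`⟨u ∪ g xd_i, [A]⟩ = ⟨g⁻¹u ∪ xd_i, [A]⟩` — the Casimir class on `A^{×2}` is LEFSCHETZ (§M1), hence fixed by `G₁`; compare Künneth
coefficients.
-- adapted from Summits/…/Ring2HypothesesDescentAbsoluteExteriorPullbacks.lean (`AlgebraicStabilizerExterior.cupPairing_apply_dual`,
-- hypothesis `hfix` moved from the algebraic system to the Lefschetz system)
[cite: Milne1999LefschetzClasses, Cor. 5.8 (p. 664)] [cite: vanGeemen1994HodgeAV, 6.5] [cite: VoisinHodgeI2002, §11.3.3 Lemma 11.41] -/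
theorem cupPairing_apply_dual (hG : IsKunnethFamily A.X G) (h0 : G 0 = g)
    (hfix : ∀ (a p : ℕ), ∀ x ∈ lefschetzPowClasses A.dim A.X a p, G a (2 * p) x = x)
    {k d : ℕ} (hkd : k + d = 2 * A.dim) {ι : Type} [Fintype ι] [DecidableEq ι]
    (x : Module.Basis ι ℂ (complexBetti A.X k)) {xd : ι → complexBetti A.X d} {c : ℂ}
    (hc : c ≠ 0) (hd : ∀ i j, cupPairing (complexOrientationFamily (AbelianVariety.isSmoothProjective_holds (A := A))) hkd
      (x i) (xd j) = if i = j then c else 0)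
    (u : complexBetti A.X k) (i : ι) :
    cupPairing (complexOrientationFamily (AbelianVariety.isSmoothProjective_holds (A := A))) hkd u (g d (xd i)) =
      cupPairing (complexOrientationFamily (AbelianVariety.isSmoothProjective_holds (A := A))) hkd ((g k).symm u) (xd i) := by
  classical
  have hX : IsSmoothProjective A.dim A.X := AbelianVariety.isSmoothProjective_holds (A := A)
  -- the Casimir class on `A ⊗ A = A^{×2}` and its invariance
  set γ : complexBetti (cartesianPow A.X 2) (2 * A.dim) :=
    ∑ i, cupProduct hkd (complexBetti.map (fst A.X A.X) k (x i)) (complexBetti.map (snd A.X A.X) d (xd i)) with hγ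
  have hγmem : γ ∈ lefschetzPowClasses A.dim A.X 1 A.dim := casimirClass_mem_lefschetzPowClasses A hkd x hc hd
  have hinv := hfix 1 A.dim γ hγmem
  have hGγ : G 1 (2 * A.dim) γ = ∑ i, cupProduct hkd (complexBetti.map (fst A.X A.X) k (g k (x i)))
      (complexBetti.map (snd A.X A.X) d (g d (xd i))) := by
    rw [hγ, map_sum]
    exact Finset.sum_congr rfl fun i _ ↦ AlgebraicStabilizerExterior.cross_zero hG h0 k d (2 * A.dim) hkd (x i) (xd i)
  rw [hGγ, hγ] at hinv
  -- normalised dual and expansion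
  have hnorm : ∀ i j, cupPairing (complexOrientationFamily hX) hkd (x i) (c⁻¹ • xd j) = if i = j then 1 else 0 := by
    intro i j
    rw [map_smul, hd, smul_eq_mul]
    split_ifs
    · exact inv_mul_cancel₀ hc
    · exact mul_zero _
  have hexp : ∀ w : complexBetti A.X k, ∑ i, cupPairing (complexOrientationFamily hX) hkd w (xd i) • x i = c • w := by
    intro w
    have h1 := PerfPairDuality.eq_sum_smul_self x hnorm w
    rw [h1, Finset.smul_sum]
    conv_lhs => rw [← h1]
    refine Finset.sum_congr rfl fun i _ ↦ ?_
    rw [map_smul, smul_eq_mul, smul_smul, mul_inv_cancel_left₀ hc]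
  have key : ∀ w : complexBetti A.X k,
      ∑ i, cupPairing (complexOrientationFamily hX) hkd w (g d (xd i)) • g k (x i) = c • w := fun w ↦
    (HodgeGroupExterior.sum_smul_eq_of_sum_cross_eq hX hX hkd (by omega) (fun i ↦ g k (x i)) (fun i ↦ x i)
      (fun i ↦ g d (xd i)) (fun i ↦ xd i) hinv (cupPairing (complexOrientationFamily hX) hkd w)).trans (hexp w)
  -- apply `g⁻¹` and compare coordinates in the basis `x`
  have key' : ∑ i, cupPairing (complexOrientationFamily hX) hkd u (g d (xd i)) • x i =
      ∑ i, cupPairing (complexOrientationFamily hX) hkd ((g k).symm u) (xd i) • x i := by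
    have h := congrArg (g k).symm (key u)
    rw [map_sum] at h
    simp_rw [map_smul, LinearEquiv.symm_apply_apply] at h
    rw [h, hexp]
  exact Fintype.linearIndependent_iffₛ.1 x.linearIndependent _ _ key' i

/-- **The Künneth extension `G₁` of `g` commutes with pull-back along every HOMOMORPHISM `F : A × A → A`**: `G₁ (F^* y) = F^* (g y)` on
every `Hᵏ(A(ℂ); ℂ)` — through the transposed graph-type class `Σ_i pr^* F^* x_i ∪ pr^* xd_i` on `A^{×3}`, which is LEFSCHETZ (§M1,
`graphTypeClass_mem_lefschetzPowClasses`), hence fixed by `G₂`; uniqueness of Künneth coefficients and `cupPairing_apply_dual`.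
-- adapted from Summits/…/Ring2HypothesesDescentAbsoluteExteriorPullbacks.lean (`AlgebraicStabilizerExterior.apply_map` at `a = 1`,
-- morphisms restricted to homomorphisms, `hfix` moved from the algebraic system to the Lefschetz system)
[cite: Milne1999LefschetzClasses, Cor. 5.6 (p. 663) and Prop. 5.7 (p. 664)] [cite: Deligne1982HodgeCycles, I §3 Prop. 3.4]
[cite: VoisinHodgeI2002, §11.3.3 Lemma 11.41] -/
theorem apply_map (hG : IsKunnethFamily A.X G) (h0 : G 0 = g)
    (hfix : ∀ (a p : ℕ), ∀ x ∈ lefschetzPowClasses A.dim A.X a p, G a (2 * p) x = x)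
    (f : cartesianPow A.X (1 + 1) ⟶ A.X) (hf : ∃ F : A.powSucc 1 ⟶ A, F.hom.hom.hom = f) (k : ℕ) (y : complexBetti A.X k) :
    G 1 k (complexBetti.map f k y) = complexBetti.map f k (g k y) := by
  classical
  have hX : IsSmoothProjective A.dim A.X := AbelianVariety.isSmoothProjective_holds (A := A)
  by_cases hk : 2 * A.dim < k
  · haveI := subsingleton_complexBetti hX hk
    have hy : y = 0 := Subsingleton.elim y 0
    subst hy
    simp only [map_zero]
  obtain ⟨d, hkd⟩ : ∃ d, k + d = 2 * A.dim := ⟨2 * A.dim - k, by omega⟩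
  obtain ⟨N, x, xd, c, hc, -, -, hdual⟩ := exists_rational_dual complexOrientationFamily hX hkd
  have hXa := isSmoothProjective_cartesianPow hX 1
  -- the transposed graph class on `A^{×2} ⊗ A = A^{×3}` and its invariance
  set γ : complexBetti (cartesianPow A.X (1 + 2)) (2 * A.dim) :=
    ∑ i, cupProduct hkd (complexBetti.map (fst (cartesianPow A.X (1 + 1)) A.X) k (complexBetti.map f k (x i)))
      (complexBetti.map (snd (cartesianPow A.X (1 + 1)) A.X) d (xd i)) with hγ
  have hγmem : γ ∈ lefschetzPowClasses A.dim A.X (1 + 1) A.dim := graphTypeClass_mem_lefschetzPowClasses A f hf hkd x hc hdual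
  have hinv := hfix (1 + 1) A.dim γ hγmem
  have hGγ : G (1 + 1) (2 * A.dim) γ =
      ∑ i, cupProduct hkd (complexBetti.map (fst (cartesianPow A.X (1 + 1)) A.X) k (G 1 k (complexBetti.map f k (x i))))
        (complexBetti.map (snd (cartesianPow A.X (1 + 1)) A.X) d (g d (xd i))) := by
    rw [hγ, map_sum]
    exact Finset.sum_congr rfl fun i _ ↦ AlgebraicStabilizerExterior.cross_succ hG h0 1 k d (2 * A.dim) hkd _ (xd i)
  rw [hGγ, hγ] at hinv
  -- normalised dual and expansion
  have hnorm : ∀ i j, cupPairing (complexOrientationFamily hX) hkd (x i) (c⁻¹ • xd j) = if i = j then 1 else 0 := by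
    intro i j
    rw [map_smul, hdual, smul_eq_mul]
    split_ifs
    · exact inv_mul_cancel₀ hc
    · exact mul_zero _
  have hexp : ∀ w : complexBetti A.X k, ∑ i, cupPairing (complexOrientationFamily hX) hkd w (xd i) • x i = c • w := by
    intro w
    have h1 := PerfPairDuality.eq_sum_smul_self x hnorm w
    rw [h1, Finset.smul_sum]
    conv_lhs => rw [← h1]
    refine Finset.sum_congr rfl fun i _ ↦ ?_
    rw [map_smul, smul_eq_mul, smul_smul, mul_inv_cancel_left₀ hc]
  -- extract with the functional `⟨u, ·⟩`, `u = g y`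
  have h := HodgeGroupExterior.sum_smul_eq_of_sum_cross_eq hXa hX hkd (by omega)
    (fun i ↦ G 1 k (complexBetti.map f k (x i))) (fun i ↦ complexBetti.map f k (x i))
    (fun i ↦ g d (xd i)) (fun i ↦ xd i) hinv (cupPairing (complexOrientationFamily hX) hkd (g k y))
  -- RHS: `Σ ⟨u, xd_i⟩ f^* x_i = c • f^* u`
  have hR : ∑ i, cupPairing (complexOrientationFamily hX) hkd (g k y) (xd i) • complexBetti.map f k (x i) =
      c • complexBetti.map f k (g k y) := by
    rw [← map_smul, ← hexp (g k y), map_sum]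
    simp_rw [map_smul]
  -- LHS: `Σ ⟨u, g xd_i⟩ G₁ f^* x_i = Σ ⟨g⁻¹ u, xd_i⟩ G₁ f^* x_i = c • G₁ f^* y`
  have hL : ∑ i, cupPairing (complexOrientationFamily hX) hkd (g k y) (g d (xd i)) • G 1 k (complexBetti.map f k (x i)) =
      c • G 1 k (complexBetti.map f k y) := by
    simp_rw [cupPairing_apply_dual hG h0 hfix hkd x hc hdual (g k y)]
    rw [LinearEquiv.symm_apply_apply, ← map_smul, ← map_smul, ← hexp y, map_sum, map_sum]
    simp_rw [map_smul]
  have h' : c • G 1 k (complexBetti.map f k y) = c • complexBetti.map f k (g k y) := by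
    rw [← hL, ← hR]; exact h
  exact smul_right_injective _ hc h'

/-- **A Künneth family fixing the Lefschetz classes preserves the cup (Poincaré) pairing**: `⟨g x ∪ g y, [A(ℂ)]⟩ = ⟨x ∪ y, [A(ℂ)]⟩`
for `x ∈ Hᵏ`, `y ∈ H^{2n-k}` (van Geemen 6.5 «`G ⊂ Sp(E)`»; complex orientation).
-- adapted from Summits/…/Ring2HypothesesDescentAbsoluteExteriorPullbacks.lean (`AlgebraicStabilizerExterior.cupPairing_eq`)
[cite: vanGeemen1994HodgeAV, 6.5] [cite: HatcherAT2002, §3.3 Prop. 3.38] -/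
theorem cupPairing_eq (hG : IsKunnethFamily A.X G) (h0 : G 0 = g)
    (hfix : ∀ (a p : ℕ), ∀ x ∈ lefschetzPowClasses A.dim A.X a p, G a (2 * p) x = x)
    {k d : ℕ} (hkd : k + d = 2 * A.dim) (x : complexBetti A.X k) (y : complexBetti A.X d) :
    cupPairing (complexOrientationFamily (AbelianVariety.isSmoothProjective_holds (A := A))) hkd (g k x) (g d y) =
      cupPairing (complexOrientationFamily (AbelianVariety.isSmoothProjective_holds (A := A))) hkd x y := by
  classical
  have hX : IsSmoothProjective A.dim A.X := AbelianVariety.isSmoothProjective_holds (A := A)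
  obtain ⟨N, b, bd, c, hc, -, -, hdual⟩ := exists_rational_dual complexOrientationFamily hX hkd
  have hspan := AlgebraicStabilizerExterior.span_dual_eq_top hX hkd b complexOrientationFamily hc hdual
  have key : (cupPairing (complexOrientationFamily hX) hkd (g k x)) ∘ₗ (g d : complexBetti A.X d →ₗ[ℂ] complexBetti A.X d) =
      cupPairing (complexOrientationFamily hX) hkd x := by
    refine LinearMap.ext_on_range hspan fun i ↦ ?_
    rw [LinearMap.comp_apply, LinearEquiv.coe_coe,
      cupPairing_apply_dual hG h0 hfix hkd b hc hdual (g k x) i, LinearEquiv.symm_apply_apply]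
  exact LinearMap.congr_fun key y

/-- **A Künneth family fixing the Lefschetz classes acts trivially on the top cohomology** `H^{2n}(A(ℂ); ℂ)` (`g 1 = 1` because `1` is
Lefschetz; `⟨g z ∪ g 1, [A]⟩ = ⟨z ∪ 1, [A]⟩`, and top classes are detected by the fundamental class) — Milne, proof of Prop. 5.4:
«`H^{2g}(A)(g)` consists of Lefschetz classes […] the action of `L(A)` on it is trivial».
-- adapted from Summits/…/Ring2HypothesesDescentAbsoluteExteriorPullbacks.lean (`AlgebraicStabilizerExterior.apply_top`)
[cite: Milne1999LefschetzClasses, Prop. 5.4 (proof, p. 663)] [cite: HatcherAT2002, §3.3 Thm. 3.26] -/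
theorem apply_top (hG : IsKunnethFamily A.X G) (h0 : G 0 = g)
    (hfix : ∀ (a p : ℕ), ∀ x ∈ lefschetzPowClasses A.dim A.X a p, G a (2 * p) x = x)
    (z : complexBetti A.X (2 * A.dim)) : g (2 * A.dim) z = z := by
  have hX : IsSmoothProjective A.dim A.X := AbelianVariety.isSmoothProjective_holds (A := A)
  have hone : g 0 (singularCohomology.one ℂ (ComplexPoints A.X)) = singularCohomology.one ℂ (ComplexPoints A.X) := by
    have := hfix 0 0 _ (one_mem_lefschetzPowClasses_zero A)
    rw [h0] at this
    exact this
  have hpair := cupPairing_eq hG h0 hfix (Nat.add_zero (2 * A.dim)) z (singularCohomology.one ℂ (ComplexPoints A.X))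
  rw [hone, cupPairing_apply, cupPairing_apply, cupProduct_one, cupProduct_one] at hpair
  have hsub : kroneckerPairing ℂ ℂ (ComplexPoints A.X) (2 * A.dim) (g (2 * A.dim) z - z)
      (complexOrientationFamily hX).fundamentalClass = 0 := by
    rw [map_sub, LinearMap.sub_apply, hpair, sub_self]
  exact sub_eq_zero.1 (top_eq_zero_of_kroneckerPairing_eq_zero hX (complexOrientationFamily hX) hsub)

end Comm

/-! ## §M3 The action on `Hᵏ(A(ℂ); ℂ) = ⋀ᵏH¹` through `H¹` -/

section Abelian

variable (A : AbelianVariety ℂ)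
  {g : ∀ k : ℕ, complexBetti A.X k ≃ₗ[ℂ] complexBetti A.X k}
  {G : ∀ a k : ℕ, complexBetti (cartesianPow A.X (a + 1)) k ≃ₗ[ℂ] complexBetti (cartesianPow A.X (a + 1)) k}
  {G1 : ∀ k : ℕ, complexBetti (A.X ⊗ A.X) k ≃ₗ[ℂ] complexBetti (A.X ⊗ A.X) k}

variable {A}

/-- `G₁` commutes with `f^*` for every `f : A × A → A` underlying a HOMOMORPHISM (typed copy of `apply_map`).
-- adapted from Summits/…/Ring2HypothesesDescentAbsoluteExteriorAction.lean (`AlgebraicStabilizerExterior.one_apply_map`)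
[folklore] -/
theorem one_apply_map (hG : IsKunnethFamily A.X G) (h0 : G 0 = g) (h1 : G 1 = G1)
    (hfix : ∀ (a p : ℕ), ∀ x ∈ lefschetzPowClasses A.dim A.X a p, G a (2 * p) x = x)
    (f : A.X ⊗ A.X ⟶ A.X) (hf : ∃ F : A.powSucc 1 ⟶ A, F.hom.hom.hom = f) (k : ℕ) (y : complexBetti A.X k) :
    G1 k (complexBetti.map f k y) = complexBetti.map f k (g k y) := by
  have := apply_map hG h0 hfix f hf k y
  rw [h1] at this
  exact this

/-- **van Geemen 6.5 for a Künneth family fixing only the LEFSCHETZ classes on the powers of `A`** — in particular for every element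
of Milne's Tannaka-free `S(A)`: `g = G₀` satisfies `g_k(v₁ ∪ ⋯ ∪ v_k) = g₁v₁ ∪ ⋯ ∪ g₁v_k` for all `k` and `vᵢ ∈ H¹(A(ℂ); ℂ)` —
induction on `k` with the averaging operator `𝒞 = Σ_p w_p (p·pr₁ + pr₂)^*` over the HOMOMORPHISMS `p·pr₁ + pr₂ : A² → A` (which
commutes with `G`, `one_apply_map`: their transposed graph-type classes are LEFSCHETZ), `𝒞(∪vᵢ) = Σᵢ Mᵢ(v)` and `Δ^* ∘ 𝒞 = (k+1)·id`
(gen 84's hypothesis-free `avg_cupPowOne`, `diag_avg`); the Lagrange weights are ring2-ab-andre-2's `exists_vandermonde_solution`.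
-- adapted from Summits/…/Ring2HypothesesDescentAbsoluteExteriorAction.lean (`AlgebraicStabilizerExterior.apply_cupPowOne`,
-- hypothesis `hfix` moved from the algebraic system to the Lefschetz system)
[cite: vanGeemen1994HodgeAV, 6.4–6.5] [cite: LangeBirkenhake1992, §1.1 (p. 19) and Lemma 1.1.17] [cite: Milne1999LefschetzClasses, Thm. 4.4 (p. 659)] -/
theorem apply_cupPowOne (hG : IsKunnethFamily A.X G) (h0 : G 0 = g) (h1 : G 1 = G1)
    (hfix : ∀ (a p : ℕ), ∀ x ∈ lefschetzPowClasses A.dim A.X a p, G a (2 * p) x = x) :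
    ∀ (k : ℕ) (v : Fin k → complexBetti A.X 1),
      g k (cupPowOne ℂ (ComplexPoints A.X) k v) = cupPowOne ℂ (ComplexPoints A.X) k (fun j ↦ g 1 (v j)) := by
  -- the homomorphisms `f_p = p·pr₁ + pr₂ : A × A → A` as morphisms of `ℂ`-schemes, `f_p^* = p·pr₁^* + pr₂^*` on `H¹`
  let fp : ℕ → (A.X ⊗ A.X ⟶ A.X) := fun p ↦ (p • AbelianVariety.fst A A + AbelianVariety.snd A A).hom.hom.hom
  have hfhom : ∀ p : ℕ, ∃ F : A.powSucc 1 ⟶ A, F.hom.hom.hom = fp p :=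
    fun p ↦ ⟨p • AbelianVariety.fst A A + AbelianVariety.snd A A, rfl⟩
  have hfp : ∀ (p : ℕ) (x : complexBetti A.X 1), complexBetti.map (fp p) 1 x =
      (p : ℂ) • complexBetti.map (fst A.X A.X) 1 x + complexBetti.map (snd A.X A.X) 1 x :=
    fun p x ↦ AlgebraicStabilizerExterior.map_fpX_one A p x
  intro k
  induction k with
  | zero =>
    intro v
    rw [cupPowOne_zero, cupPowOne_zero]
    have := hfix 0 0 _ (one_mem_lefschetzPowClasses_zero A)
    rw [h0] at this
    exact this
  | succ k ih =>
    intro v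
    obtain ⟨w, hw⟩ := Ring2.AbelianAll.exists_vandermonde_solution (k + 1) 1
    -- `𝒞 (g y) = G₁ (𝒞 y) = G₁ (Σ M_i v) = Σ M_i (g ∘ v) = 𝒞 (∪ g v_j)`
    have hC : ∑ p : Fin (k + 2), w p • complexBetti.map (fp p) (k + 1) (g (k + 1) (cupPowOne ℂ (ComplexPoints A.X) (k + 1) v)) =
        ∑ p : Fin (k + 2), w p • complexBetti.map (fp p) (k + 1)
          (cupPowOne ℂ (ComplexPoints A.X) (k + 1) (fun j ↦ g 1 (v j))) := by
      have step : (∑ p : Fin (k + 2), w p • complexBetti.map (fp p) (k + 1)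
          (g (k + 1) (cupPowOne ℂ (ComplexPoints A.X) (k + 1) v))) =
          G1 (k + 1) (∑ p : Fin (k + 2), w p • complexBetti.map (fp p) (k + 1) (cupPowOne ℂ (ComplexPoints A.X) (k + 1) v)) := by
        rw [map_sum]
        refine Finset.sum_congr rfl fun p _ ↦ ?_
        rw [map_smul, one_apply_map hG h0 h1 hfix (fp p) (hfhom p) (k + 1)]
      rw [step, AlgebraicStabilizerExterior.avg_cupPowOne fp hfp hw, AlgebraicStabilizerExterior.avg_cupPowOne fp hfp hw, map_sum]
      exact Finset.sum_congr rfl fun i _ ↦ AlgebraicStabilizerExterior.kunneth_M1 hG h0 h1 k ih v i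
    have h2 := congrArg (complexBetti.map (CartesianMonoidalCategory.lift (𝟙 A.X) (𝟙 A.X)) (k + 1)) hC
    rw [AlgebraicStabilizerExterior.diag_avg fp hfp hw, AlgebraicStabilizerExterior.diag_avg fp hfp hw] at h2
    exact smul_right_injective _ (Nat.cast_ne_zero.2 (Nat.succ_ne_zero k)) h2

/-- `g₀ 1 = 1` on `H⁰(A(ℂ); ℂ)` (`1` is a Lefschetz class). [folklore] -/
theorem apply_one (h0 : G 0 = g) (hfix : ∀ (a p : ℕ), ∀ x ∈ lefschetzPowClasses A.dim A.X a p, G a (2 * p) x = x) :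
    g 0 (singularCohomology.one ℂ (ComplexPoints A.X)) = singularCohomology.one ℂ (ComplexPoints A.X) := by
  have := hfix 0 0 _ (one_mem_lefschetzPowClasses_zero A)
  rw [h0] at this
  exact this

end Abelian

end SpecialLefschetzExterior

end Summit.HodgeConjecture.HodgeConjecture.Ring2.Hypotheses

end
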